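import Mathlib
import HarnessLib
import Literature.MathematicalPhysics.QuantumLattice.HubbardBandSectorCountingCounts
import Summits.HubbardSuperconductivity.HubbardSuperconductivity.Theorems.KLProgrammeCountPairsOffset

/-!
# Route `KLProgramme` — crux K1 `H10TwoPointLimit` (stmt-HubbardSuperconductivity-19938):
# the sector count modulo `2πℤ²` against an ARBITRARY momentum offset (DECOMP App. F Cor. F.3)

The `2n`-leg sector counting factor of Benfatto–Giuliani–Mastropietro 2006 ((2.76)/(2.80): with `2n - 3` sectors of a
`2n`-leg vertex fixed, the number of sector pairs for two further legs compatible with the last leg lying on the Fermi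
curve is `≤ C γ^{-h}|h|`) at INTERMEDIATE filling and modulo `2πℤ²` — BGM use the constraint only for `|P_v| ≤ 8` and only
at low density, where umklapp is absent. Here: for every level window `[μ₁, μ₂] ⊂ (-4, 0)` there is `K` such that for
every `μ` in the window, every scale `n` (isotropic sectors of width `π/2ⁿ`), every reciprocal vector `2πG` and EVERY offset
`P₀ ∈ ℝ²` (the sum of the momenta of the fixed legs — arbitrary, so the statement serves all `n` at once and also the
two-constraint step of the Cooper/non-Cooper split, whose second offset is the first step's solution), the number of
sector triples `(ω₂, ω₃, ω₄)` admitting shell momenta with `P₀ + k₂ + k₃ + k₄ = 2πG` is `≤ K·2ⁿ·(n+1)`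
(`offsetSectorCount`); more generally `|P₀ + k₂ + k₃ + k₄ - 2πG|_∞ ≤ c·π/2ⁿ` — the offset itself known only up to a cell,
as for the ANCHORED leg of an endpoint sum (BGM (2.96)) — costs only a larger constant (`offsetSectorCount_slack`). The tree's
`stub_fourSectorCount` (ThermalWedge) is the case `P₀` = a shell momentum in a fixed sector. Ingredients: cell geometry `cell`, elimination of the last leg `card_prod3_le`/`card_grid_in_box_le` (tree), the
sum-to-level reduction for an exact offset `abs_hfunP_le_of_sum` (this file), and the arbitrary-offset two-dimensional count
`count_pairs_offset_exists` (`KLProgrammeCountPairsOffset.lean`, item `CountPairsOffset`). This is the formal content of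
the C5a kill test of the cell gate-hubbard-kl (DECOMP §4): no `γ`-power is lost in the 6/8-leg (any-leg) count at this
filling. References: BGM 2006, Ann. Henri Poincaré 7, 809–898, Lemma 3.1, (2.76), (2.80), App. A2; HOME/prover-p4/COUNTING-NOTE.md.
-/

noncomputable section

namespace Summit.HubbardSuperconductivity.HubbardSuperconductivity.Theorems.CountPairsOffset

set_option linter.dupNamespace false -- summit = problem name (single-conjunct summit), D-0017

open Real Set
open Literature.MathematicalPhysics.QuantumLattice Literature.MathematicalPhysics.QuantumLattice.BandSectorCounting

/-! ## The `2n`-leg sector count modulo `2πℤ²` (Cor. F.3): three sectors against an arbitrary momentum offset -/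

section OffsetSum

variable {a b : ℝ} (B : BandBounds a b) {μ : ℝ} (hμ : μ ∈ Icc a b)
include B hμ

/-- **From the sum condition to the offset level function**: if `p(θ₄)` completes `P + p(θ₂) + p(θ₃)` to `2πG` within `r`
(coordinatewise) then `|h_P(θ₂, θ₃)| ≤ 4r`. (The tree's `abs_hfun_le_of_sum` with the first curve point replaced by the
exact offset `P`.) -/
theorem abs_hfunP_le_of_sum {P : ℝ × ℝ} {θ₂ θ₃ θ₄ r : ℝ} {G₀ G₁ : ℤ}
    (hx : |P.1 + bandX μ θ₂ + bandX μ θ₃ + bandX μ θ₄ - 2 * π * G₀| ≤ r)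
    (hy : |P.2 + bandY μ θ₂ + bandY μ θ₃ + bandY μ θ₄ - 2 * π * G₁| ≤ r) :
    |hfunP μ P θ₂ θ₃| ≤ 4 * r := by
  obtain ⟨h1, h2⟩ := B.level hμ
  set e₀ := P.1 + bandX μ θ₂ + bandX μ θ₃ + bandX μ θ₄ - 2 * π * G₀ with he₀
  set e₁ := P.2 + bandY μ θ₂ + bandY μ θ₃ + bandY μ θ₄ - 2 * π * G₁ with he₁
  have hSX : SXP μ P θ₂ θ₃ = (-bandX μ θ₄ + e₀) - (-G₀ : ℤ) * (2 * π) := by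
    unfold SXP; rw [he₀]; push_cast; ring
  have hSY : SYP μ P θ₂ θ₃ = (-bandY μ θ₄ + e₁) - (-G₁ : ℤ) * (2 * π) := by
    unfold SYP; rw [he₁]; push_cast; ring
  have hμ4 : eps2 (-bandX μ θ₄) (-bandY μ θ₄) = μ := by rw [eps2_neg]; exact eps2_bandXY h1 h2 θ₄
  unfold hfunP
  rw [hSX, hSY, eps2_sub_int_mul]
  have hrw : eps2 (-bandX μ θ₄ + e₀) (-bandY μ θ₄ + e₁) - μ =
      eps2 (-bandX μ θ₄ + e₀) (-bandY μ θ₄ + e₁) - eps2 (-bandX μ θ₄) (-bandY μ θ₄) := by rw [hμ4]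
  rw [hrw]
  calc |eps2 (-bandX μ θ₄ + e₀) (-bandY μ θ₄ + e₁) - eps2 (-bandX μ θ₄) (-bandY μ θ₄)|
      ≤ 2 * (|(-bandX μ θ₄ + e₀) - (-bandX μ θ₄)| + |(-bandY μ θ₄ + e₁) - (-bandY μ θ₄)|) := abs_eps2_sub_eps2_le _ _ _ _
    _ = 2 * (|e₀| + |e₁|) := by ring_nf
    _ ≤ 4 * r := by linarith

end OffsetSum

end Summit.HubbardSuperconductivity.HubbardSuperconductivity.Theorems.CountPairsOffset

namespace Summit.HubbardSuperconductivity.HubbardSuperconductivity.Theorems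

open Classical
open Real Set
open Literature.MathematicalPhysics.QuantumLattice Literature.MathematicalPhysics.QuantumLattice.BandSectorCounting
open Summit.HubbardSuperconductivity.HubbardSuperconductivity.Theorems.CountPairsOffset

set_option linter.dupNamespace false in -- summit = problem name (single-conjunct summit), D-0017
set_option maxHeartbeats 800000 in
/-- **The sector count against an arbitrary momentum offset KNOWN UP TO `c·w`, modulo `2πℤ²`** (DECOMP App. F Cor. F.3 = the `2n`-leg sector
count of BGM 2006 (2.76)/(2.80), for ALL numbers of legs, at every level in a compact of the hole-doped band): for every
`P₀ ∈ ℝ²` (e.g. the sum of the momenta of the `2n - 3` fixed legs of a `2n`-leg vertex) and every reciprocal vector `2πG`,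
the number of sector triples `(ω₂, ω₃, ω₄)` of angular width `π/2ⁿ` for which momenta of the shell `|ε - μ| ≤ π/2ⁿ` in the
prescribed sectors can satisfy `|P₀ + k₂ + k₃ + k₄ - 2πG|_∞ ≤ c·w` (`w = π/2ⁿ`; `c = 0` is the exact constraint, `c > 0`
lets the offset itself range over a cell — e.g. the ANCHORED leg of BGM's endpoint sums (2.96) varies within its own sector)
is at most `K·2ⁿ·(n+1)`, with `K = K(μ₁, μ₂, c)` INDEPENDENT of `P₀`, `G` and `μ ∈ [μ₁, μ₂]` — the `γ^{-h}|h|` factor of BGM's isotropic four-sector lemma (the tree's `stub_fourSectorCount` is the case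
`P₀` = a shell momentum in a fixed sector). Proof: cell geometry for the three legs, elimination of the last leg
(`card_prod3_le`, `card_grid_in_box_le`), the sum condition gives `|h_{P₀}| ≤ 12 D w` (`abs_hfunP_le_of_sum`), and the
arbitrary-offset two-dimensional count `count_pairs_offset_exists` (input (E) of Paper 1's Theorem 2.1 at intermediate filling,
HOME/prover-p4/COUNTING-NOTE-2.md §5(b′)). -/
theorem offsetSectorCount_slack :
    ∀ μ₁ μ₂ cS : ℝ, -4 < μ₁ → μ₁ ≤ μ₂ → μ₂ < 0 → 0 ≤ cS → ∃ K : ℝ, 0 < K ∧ ∀ μ ∈ Set.Icc μ₁ μ₂, ∀ (n : ℕ) (G : Fin 2 → ℤ) (P₀ : Fin 2 → ℝ),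
      (((Finset.univ : Finset (Fin (sectorCount n) × Fin (sectorCount n) × Fin (sectorCount n))).filter (fun ω : Fin (sectorCount n) × Fin (sectorCount n) × Fin (sectorCount n) =>
        ∃ k : Fin 3 → Fin 2 → ℝ, (∀ j i, |k j i| < Real.pi) ∧ (∀ j, |sqDispersion (k j) - μ| ≤ sectorWidth n) ∧
          sectorIndex n (Complex.arg (⟨k 0 0, k 0 1⟩ : ℂ)) = (ω.1 : ℕ) ∧
          sectorIndex n (Complex.arg (⟨k 1 0, k 1 1⟩ : ℂ)) = (ω.2.1 : ℕ) ∧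
          sectorIndex n (Complex.arg (⟨k 2 0, k 2 1⟩ : ℂ)) = (ω.2.2 : ℕ) ∧
          (∀ i, |P₀ i + ∑ j, k j i - 2 * Real.pi * (G i : ℝ)| ≤ cS * sectorWidth n))).card : ℝ) ≤ K * 2 ^ n * ((n : ℝ) + 1) := by
  intro μ₁ μ₂ cS hμ₁ h12 hμ₂ hc
  -- the level range `[a', b']` and its uniform bounds
  have ha : -4 < (μ₁ - 4) / 2 := by linarith
  have hab : (μ₁ - 4) / 2 ≤ μ₂ / 2 := by linarith
  have hb : μ₂ / 2 < 0 := by linarith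
  obtain ⟨B, -⟩ : ∃ B : BandBounds ((μ₁ - 4) / 2) (μ₂ / 2), B = bandBounds ha hab hb := ⟨_, rfl⟩
  have hm₀ : 0 < min (μ₁ - (μ₁ - 4) / 2) (μ₂ / 2 - μ₂) := lt_min (by linarith) (by linarith)
  obtain ⟨τ, lam, η₀, η₁, hτ, hτπ, hlam, hη₀, hη₀m, hη₁, hcov, hodd, heven, hH⟩ :=
    exists_small_constants_offset B hm₀
  have hD := B.Dcell_pos
  have hCδ : 0 < 4 * (3 * B.Dcell + cS) := by positivity
  obtain ⟨Kp, hKp, hcount⟩ := count_pairs_offset_exists B hCδ hτ hτπ hlam hη₀ hη₁ hcov hodd heven hH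
  have hum := B.umin_pos
  have hπ := Real.pi_pos
  -- the threshold on `w` and the two constants
  obtain ⟨w₀, hw₀⟩ : ∃ w₀ : ℝ, w₀ = min 1 (min (min (μ₁ - (μ₁ - 4) / 2) (μ₂ / 2 - μ₂)) (η₀ / (4 * (4 * (3 * B.Dcell + cS))))) := ⟨_, rfl⟩
  have hw₀pos : 0 < w₀ := by rw [hw₀]; exact lt_min (by norm_num) (lt_min hm₀ (by positivity))
  obtain ⟨C₀, hC₀⟩ : ∃ C₀ : ℝ, C₀ = 3 * (2 * (π * (Real.sqrt 2 * (3 * B.Dcell + cS) / B.umin)) + 1) := ⟨_, rfl⟩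
  have hC₀pos : 0 < C₀ := by rw [hC₀]; positivity
  obtain ⟨K₁, hK₁⟩ : ∃ K₁ : ℝ, K₁ = 8 * (π / w₀) ^ 2 := ⟨_, rfl⟩
  obtain ⟨K₂, hK₂⟩ : ∃ K₂ : ℝ, K₂ = C₀ * Kp * 3 / π := ⟨_, rfl⟩
  have hK₁pos : 0 < K₁ := by rw [hK₁]; positivity
  have hK₂pos : 0 < K₂ := by rw [hK₂]; positivity
  refine ⟨K₁ + K₂, by positivity, ?_⟩
  intro μ hμ n G P₀
  have hwpos : 0 < sectorWidth n := sectorWidth_pos n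
  have hNw : (sectorCount n : ℝ) * sectorWidth n = 2 * π := sectorCount_mul_sectorWidth n
  have h2n : (2 : ℝ) ^ n * sectorWidth n = π := by rw [sectorWidth]; field_simp
  have hNeq : sectorCount n = 2 * 2 ^ n := by unfold sectorCount; ring
  have hNreal : (sectorCount n : ℝ) = 2 * 2 ^ n := by rw [hNeq]; push_cast; ring
  have hsc : ∀ i : ℕ, sectorCenter n i = sectorWidth n / 2 + i * sectorWidth n := sectorCenter_eq n
  generalize hwdef : sectorWidth n = w at hwpos hNw h2n hsc ⊢
  have hμab : μ ∈ Icc ((μ₁ - 4) / 2) (μ₂ / 2) := ⟨by linarith only [hμ.1, hμ₁], by linarith only [hμ.2, hμ₂]⟩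
  have h2npos : (0 : ℝ) < 2 ^ n := by positivity
  set P : ℝ × ℝ := (P₀ 0, P₀ 1) with hPdef
  -- the trivial bound `N³`
  have htriv : ∀ (pr : Fin (sectorCount n) × Fin (sectorCount n) × Fin (sectorCount n) → Prop) [DecidablePred pr],
      ((((Finset.univ : Finset (Fin (sectorCount n) × Fin (sectorCount n) × Fin (sectorCount n))).filter pr).card : ℝ)) ≤ (sectorCount n : ℝ) ^ 3 := by
    intro pr _
    have h1 := Finset.card_filter_le (Finset.univ : Finset (Fin (sectorCount n) × Fin (sectorCount n) × Fin (sectorCount n))) pr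
    rw [Finset.card_univ, Fintype.card_prod, Fintype.card_prod, Fintype.card_fin] at h1
    have : ((((Finset.univ : Finset (Fin (sectorCount n) × Fin (sectorCount n) × Fin (sectorCount n))).filter pr).card : ℝ)) ≤
        ((sectorCount n * (sectorCount n * sectorCount n) : ℕ) : ℝ) := by exact_mod_cast h1
    calc _ ≤ ((sectorCount n * (sectorCount n * sectorCount n) : ℕ) : ℝ) := this
      _ = (sectorCount n : ℝ) ^ 3 := by push_cast; ring
  by_cases hwle : w ≤ w₀
  · -- the main case
    have hw1 : w ≤ 1 := hwle.trans (by rw [hw₀]; exact min_le_left _ _)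
    have hwm : w ≤ min (μ₁ - (μ₁ - 4) / 2) (μ₂ / 2 - μ₂) :=
      hwle.trans (by rw [hw₀]; exact (min_le_right _ _).trans (min_le_left _ _))
    have hwη : w ≤ η₀ / (4 * (4 * (3 * B.Dcell + cS))) := hwle.trans (by rw [hw₀]; exact (min_le_right _ _).trans (min_le_right _ _))
    have h2δ : 4 * (3 * B.Dcell + cS) * w ≤ η₀ / 2 := by
      have := mul_le_mul_of_nonneg_left hwη hCδ.le
      have e : 4 * (3 * B.Dcell + cS) * (η₀ / (4 * (4 * (3 * B.Dcell + cS)))) = η₀ / 4 := by field_simp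
      rw [e] at this; linarith only [this, hη₀]
    have hm1 : min (μ₁ - (μ₁ - 4) / 2) (μ₂ / 2 - μ₂) ≤ μ₁ - (μ₁ - 4) / 2 := min_le_left _ _
    have hm2 : min (μ₁ - (μ₁ - 4) / 2) (μ₂ / 2 - μ₂) ≤ μ₂ / 2 - μ₂ := min_le_right _ _
    have hlo : (μ₁ - 4) / 2 ≤ μ - η₀ := by linarith only [hμ.1, hη₀m, hm1]
    have hhi : μ + η₀ ≤ μ₂ / 2 := by linarith only [hμ.2, hη₀m, hm2]
    have hlom : (μ₁ - 4) / 2 ≤ μ - min (μ₁ - (μ₁ - 4) / 2) (μ₂ / 2 - μ₂) := by linarith only [hμ.1, hm1]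
    have hhim : μ + min (μ₁ - (μ₁ - 4) / 2) (μ₂ / 2 - μ₂) ≤ μ₂ / 2 := by linarith only [hμ.2, hm2]
    -- Step 1: the admissible triples have their centre sums close to `2πG - P₀`
    have hsub : (Finset.univ : Finset (Fin (sectorCount n) × Fin (sectorCount n) × Fin (sectorCount n))).filter (fun ω : Fin (sectorCount n) × Fin (sectorCount n) × Fin (sectorCount n) =>
        ∃ k : Fin 3 → Fin 2 → ℝ, (∀ j i, |k j i| < Real.pi) ∧ (∀ j, |sqDispersion (k j) - μ| ≤ w) ∧
          sectorIndex n (Complex.arg (⟨k 0 0, k 0 1⟩ : ℂ)) = (ω.1 : ℕ) ∧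
          sectorIndex n (Complex.arg (⟨k 1 0, k 1 1⟩ : ℂ)) = (ω.2.1 : ℕ) ∧
          sectorIndex n (Complex.arg (⟨k 2 0, k 2 1⟩ : ℂ)) = (ω.2.2 : ℕ) ∧ (∀ i, |P₀ i + ∑ j, k j i - 2 * Real.pi * (G i : ℝ)| ≤ cS * w)) ⊆
      (Finset.univ : Finset (Fin (sectorCount n) × Fin (sectorCount n) × Fin (sectorCount n))).filter (fun ω : Fin (sectorCount n) × Fin (sectorCount n) × Fin (sectorCount n) =>
        |P.1 + bandX μ (w / 2 + ((ω.1 : ℕ) : ℝ) * w) + bandX μ (w / 2 + ((ω.2.1 : ℕ) : ℝ) * w) +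
            bandX μ (w / 2 + ((ω.2.2 : ℕ) : ℝ) * w) - 2 * π * (G 0 : ℝ)| ≤ (3 * B.Dcell + cS) * w ∧
        |P.2 + bandY μ (w / 2 + ((ω.1 : ℕ) : ℝ) * w) + bandY μ (w / 2 + ((ω.2.1 : ℕ) : ℝ) * w) +
            bandY μ (w / 2 + ((ω.2.2 : ℕ) : ℝ) * w) - 2 * π * (G 1 : ℝ)| ≤ (3 * B.Dcell + cS) * w) := by
      intro ω hω
      rw [Finset.mem_filter] at hω
      obtain ⟨-, k, hk, hsh, hi0, hi1, hi2, hsum⟩ := hω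
      have hsh' : ∀ j, |sqDispersion (k j) - μ| ≤ sectorWidth n := by rw [hwdef]; exact hsh
      have hwm' : sectorWidth n ≤ min (μ₁ - (μ₁ - 4) / 2) (μ₂ / 2 - μ₂) := by rw [hwdef]; exact hwm
      have c0 := cell B hμab (hk 0) (hsh' 0) hwm' hlom hhim hi0
      have c1 := cell B hμab (hk 1) (hsh' 1) hwm' hlom hhim hi1
      have c2 := cell B hμab (hk 2) (hsh' 2) hwm' hlom hhim hi2
      rw [hsc, hwdef] at c0 c1 c2
      rw [Finset.mem_filter]
      refine ⟨Finset.mem_univ _, ?_, ?_⟩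
      · have hs := hsum 0
        rw [Fin.sum_univ_three] at hs
        have e : P.1 + bandX μ (w / 2 + ((ω.1 : ℕ) : ℝ) * w) + bandX μ (w / 2 + ((ω.2.1 : ℕ) : ℝ) * w) +
            bandX μ (w / 2 + ((ω.2.2 : ℕ) : ℝ) * w) - 2 * π * (G 0 : ℝ) =
            (P₀ 0 + (k 0 0 + k 1 0 + k 2 0) - 2 * Real.pi * (G 0 : ℝ)) +
            (-(k 0 0 - bandX μ (w / 2 + ((ω.1 : ℕ) : ℝ) * w)) + -(k 1 0 - bandX μ (w / 2 + ((ω.2.1 : ℕ) : ℝ) * w)) +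
            -(k 2 0 - bandX μ (w / 2 + ((ω.2.2 : ℕ) : ℝ) * w))) := by
          rw [hPdef]; ring
        rw [e]
        calc _ ≤ |P₀ 0 + (k 0 0 + k 1 0 + k 2 0) - 2 * Real.pi * (G 0 : ℝ)| +
              (|-(k 0 0 - bandX μ (w / 2 + ((ω.1 : ℕ) : ℝ) * w))| + |-(k 1 0 - bandX μ (w / 2 + ((ω.2.1 : ℕ) : ℝ) * w))| +
              |-(k 2 0 - bandX μ (w / 2 + ((ω.2.2 : ℕ) : ℝ) * w))|) :=
              (abs_add_le _ _).trans (add_le_add le_rfl ((abs_add_le _ _).trans (add_le_add (abs_add_le _ _) le_rfl)))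
          _ ≤ (3 * B.Dcell + cS) * w := by rw [abs_neg, abs_neg, abs_neg]; linarith [c0.1, c1.1, c2.1, hs]
      · have hs := hsum 1
        rw [Fin.sum_univ_three] at hs
        have e : P.2 + bandY μ (w / 2 + ((ω.1 : ℕ) : ℝ) * w) + bandY μ (w / 2 + ((ω.2.1 : ℕ) : ℝ) * w) +
            bandY μ (w / 2 + ((ω.2.2 : ℕ) : ℝ) * w) - 2 * π * (G 1 : ℝ) =
            (P₀ 1 + (k 0 1 + k 1 1 + k 2 1) - 2 * Real.pi * (G 1 : ℝ)) +
            (-(k 0 1 - bandY μ (w / 2 + ((ω.1 : ℕ) : ℝ) * w)) + -(k 1 1 - bandY μ (w / 2 + ((ω.2.1 : ℕ) : ℝ) * w)) +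
            -(k 2 1 - bandY μ (w / 2 + ((ω.2.2 : ℕ) : ℝ) * w))) := by
          rw [hPdef]; ring
        rw [e]
        calc _ ≤ |P₀ 1 + (k 0 1 + k 1 1 + k 2 1) - 2 * Real.pi * (G 1 : ℝ)| +
              (|-(k 0 1 - bandY μ (w / 2 + ((ω.1 : ℕ) : ℝ) * w))| + |-(k 1 1 - bandY μ (w / 2 + ((ω.2.1 : ℕ) : ℝ) * w))| +
              |-(k 2 1 - bandY μ (w / 2 + ((ω.2.2 : ℕ) : ℝ) * w))|) :=
              (abs_add_le _ _).trans (add_le_add le_rfl ((abs_add_le _ _).trans (add_le_add (abs_add_le _ _) le_rfl)))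
          _ ≤ (3 * B.Dcell + cS) * w := by rw [abs_neg, abs_neg, abs_neg]; linarith [c0.2, c1.2, c2.2, hs]
    -- Step 2: eliminate the last index
    have hr : 0 ≤ (3 * B.Dcell + cS) * w := by positivity
    have hT'le : ((((Finset.univ : Finset (Fin (sectorCount n) × Fin (sectorCount n) × Fin (sectorCount n))).filter (fun ω : Fin (sectorCount n) × Fin (sectorCount n) × Fin (sectorCount n) =>
        |P.1 + bandX μ (w / 2 + ((ω.1 : ℕ) : ℝ) * w) + bandX μ (w / 2 + ((ω.2.1 : ℕ) : ℝ) * w) +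
            bandX μ (w / 2 + ((ω.2.2 : ℕ) : ℝ) * w) - 2 * π * (G 0 : ℝ)| ≤ (3 * B.Dcell + cS) * w ∧
        |P.2 + bandY μ (w / 2 + ((ω.1 : ℕ) : ℝ) * w) + bandY μ (w / 2 + ((ω.2.1 : ℕ) : ℝ) * w) +
            bandY μ (w / 2 + ((ω.2.2 : ℕ) : ℝ) * w) - 2 * π * (G 1 : ℝ)| ≤ (3 * B.Dcell + cS) * w)).card : ℝ)) ≤
        C₀ * ((((Finset.range (sectorCount n) ×ˢ Finset.range (sectorCount n)).filter fun p : ℕ × ℕ =>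
          |hfunP μ P (w / 2 + p.1 * w) (w / 2 + p.2 * w)| ≤ 4 * (3 * B.Dcell + cS) * w).card : ℝ)) := by
      refine card_prod3_le (N := sectorCount n)
        (Q := fun i c d => |P.1 + bandX μ (w / 2 + i * w) + bandX μ (w / 2 + c * w) + bandX μ (w / 2 + d * w) - 2 * π * (G 0 : ℝ)| ≤ (3 * B.Dcell + cS) * w ∧
          |P.2 + bandY μ (w / 2 + i * w) + bandY μ (w / 2 + c * w) + bandY μ (w / 2 + d * w) - 2 * π * (G 1 : ℝ)| ≤ (3 * B.Dcell + cS) * w)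
        (R := fun i c => |hfunP μ P (w / 2 + i * w) (w / 2 + c * w)| ≤ 4 * (3 * B.Dcell + cS) * w) hC₀pos.le ?_ ?_
      · intro i c hi hc
        have hbox := card_grid_in_box_le B hμab hwpos hNw hr (N := sectorCount n)
          (x := 2 * π * (G 0 : ℝ) - P.1 - bandX μ (w / 2 + i * w) - bandX μ (w / 2 + c * w))
          (y := 2 * π * (G 1 : ℝ) - P.2 - bandY μ (w / 2 + i * w) - bandY μ (w / 2 + c * w))
        have heq : ((Finset.range (sectorCount n)).filter fun d : ℕ =>
            |P.1 + bandX μ (w / 2 + i * w) + bandX μ (w / 2 + c * w) + bandX μ (w / 2 + d * w) - 2 * π * (G 0 : ℝ)| ≤ (3 * B.Dcell + cS) * w ∧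
            |P.2 + bandY μ (w / 2 + i * w) + bandY μ (w / 2 + c * w) + bandY μ (w / 2 + d * w) - 2 * π * (G 1 : ℝ)| ≤ (3 * B.Dcell + cS) * w) =
            ((Finset.range (sectorCount n)).filter fun d : ℕ =>
            |bandX μ (w / 2 + d * w) - (2 * π * (G 0 : ℝ) - P.1 - bandX μ (w / 2 + i * w) - bandX μ (w / 2 + c * w))| ≤ (3 * B.Dcell + cS) * w ∧
            |bandY μ (w / 2 + d * w) - (2 * π * (G 1 : ℝ) - P.2 - bandY μ (w / 2 + i * w) - bandY μ (w / 2 + c * w))| ≤ (3 * B.Dcell + cS) * w) := by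
          refine Finset.filter_congr fun d _ => ?_
          rw [show P.1 + bandX μ (w / 2 + i * w) + bandX μ (w / 2 + c * w) + bandX μ (w / 2 + d * w) - 2 * π * (G 0 : ℝ) =
            bandX μ (w / 2 + d * w) - (2 * π * (G 0 : ℝ) - P.1 - bandX μ (w / 2 + i * w) - bandX μ (w / 2 + c * w)) by ring,
            show P.2 + bandY μ (w / 2 + i * w) + bandY μ (w / 2 + c * w) + bandY μ (w / 2 + d * w) - 2 * π * (G 1 : ℝ) =
            bandY μ (w / 2 + d * w) - (2 * π * (G 1 : ℝ) - P.2 - bandY μ (w / 2 + i * w) - bandY μ (w / 2 + c * w)) by ring]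
        rw [heq]
        refine hbox.trans (le_of_eq ?_)
        rw [hC₀]; field_simp
      · intro i c d hi hc hd hQ
        have := abs_hfunP_le_of_sum B hμab hQ.1 hQ.2
        linarith
    -- Step 3: the two-dimensional count, uniform in the offset
    have hP := hcount μ hμab hlo hhi P w (sectorCount n) (2 ^ n) n hwpos hw1 hNw
      (by push_cast; exact h2n) hNeq h2n h2δ
    clear hcount
    -- Step 4: arithmetic
    have hlogN : Real.log (sectorCount n : ℕ) ≤ (n : ℝ) + 1 := by rw [hNreal]; exact log_two_mul_two_pow_le n
    have hwinv : 1 / w = 2 ^ n / π := by rw [← h2n]; field_simp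
    have e1 := Finset.card_le_card hsub
    have e1' : ((((Finset.univ : Finset (Fin (sectorCount n) × Fin (sectorCount n) × Fin (sectorCount n))).filter (fun ω : Fin (sectorCount n) × Fin (sectorCount n) × Fin (sectorCount n) =>
        ∃ k : Fin 3 → Fin 2 → ℝ, (∀ j i, |k j i| < Real.pi) ∧ (∀ j, |sqDispersion (k j) - μ| ≤ w) ∧
          sectorIndex n (Complex.arg (⟨k 0 0, k 0 1⟩ : ℂ)) = (ω.1 : ℕ) ∧
          sectorIndex n (Complex.arg (⟨k 1 0, k 1 1⟩ : ℂ)) = (ω.2.1 : ℕ) ∧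
          sectorIndex n (Complex.arg (⟨k 2 0, k 2 1⟩ : ℂ)) = (ω.2.2 : ℕ) ∧ (∀ i, |P₀ i + ∑ j, k j i - 2 * Real.pi * (G i : ℝ)| ≤ cS * w))).card : ℝ)) ≤
        K₂ * 2 ^ n * ((n : ℝ) + 1) := by
      have e2 : Kp * ((n : ℝ) + 2 + Real.log (sectorCount n : ℕ)) / w ≤ Kp * (3 * ((n : ℝ) + 1)) / w := by
        apply div_le_div_of_nonneg_right _ hwpos.le
        apply mul_le_mul_of_nonneg_left _ hKp.le
        linarith only [hlogN]
      have e3 : Kp * (3 * ((n : ℝ) + 1)) / w = Kp * 3 / π * 2 ^ n * ((n : ℝ) + 1) := by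
        rw [div_eq_mul_one_div _ w, hwinv]; ring
      have e4 : C₀ * (Kp * 3 / π * 2 ^ n * ((n : ℝ) + 1)) = K₂ * 2 ^ n * ((n : ℝ) + 1) := by rw [hK₂]; ring
      calc _ ≤ _ := by exact_mod_cast e1
        _ ≤ C₀ * (Kp * ((n : ℝ) + 2 + Real.log (sectorCount n : ℕ)) / w) := hT'le.trans (mul_le_mul_of_nonneg_left hP hC₀pos.le)
        _ ≤ C₀ * (Kp * (3 * ((n : ℝ) + 1)) / w) := mul_le_mul_of_nonneg_left e2 hC₀pos.le
        _ = K₂ * 2 ^ n * ((n : ℝ) + 1) := by rw [e3, e4]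
    refine e1'.trans ?_
    have : 0 ≤ K₁ * 2 ^ n * ((n : ℝ) + 1) := by positivity
    linarith only [this]
  · -- small `n`: `2ⁿ < π / w₀`
    clear hcount
    push Not at hwle
    have h2nlt : (2 : ℝ) ^ n ≤ π / w₀ := by
      rw [le_div_iff₀ hw₀pos, ← h2n]
      exact mul_le_mul_of_nonneg_left hwle.le h2npos.le
    have hbound : (sectorCount n : ℝ) ^ 3 ≤ K₁ * 2 ^ n := by
      rw [hNreal, hK₁]
      have hsq : ((2 : ℝ) ^ n) ^ 2 ≤ (π / w₀) ^ 2 := pow_le_pow_left₀ h2npos.le h2nlt 2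
      have e : (2 * (2 : ℝ) ^ n) ^ 3 = 8 * ((2 : ℝ) ^ n) ^ 2 * 2 ^ n := by ring
      rw [e]
      exact mul_le_mul_of_nonneg_right (mul_le_mul_of_nonneg_left hsq (by norm_num)) h2npos.le
    refine (htriv _).trans (hbound.trans ?_)
    have h1 : K₁ * 2 ^ n ≤ (K₁ + K₂) * 2 ^ n := mul_le_mul_of_nonneg_right (by linarith only [hK₂pos]) h2npos.le
    have h2 : (K₁ + K₂) * 2 ^ n ≤ (K₁ + K₂) * 2 ^ n * ((n : ℝ) + 1) :=
      le_mul_of_one_le_right (by positivity) (by linarith only [(by positivity : (0:ℝ) ≤ n)])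
    linarith only [h1, h2]

set_option linter.dupNamespace false in -- summit = problem name (single-conjunct summit), D-0017
/-- **The sector count against an arbitrary momentum offset, modulo `2πℤ²`** (DECOMP App. F Cor. F.3 = the `2n`-leg sector
count of BGM 2006 (2.76)/(2.80), for ALL numbers of legs, at every level in a compact of the hole-doped band): for every
`P₀ ∈ ℝ²` (e.g. the sum of the momenta of the `2n - 3` fixed legs of a `2n`-leg vertex) and every reciprocal vector `2πG`,
the number of sector triples `(ω₂, ω₃, ω₄)` of angular width `π/2ⁿ` for which momenta of the shell `|ε - μ| ≤ π/2ⁿ` in the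
prescribed sectors can satisfy `P₀ + k₂ + k₃ + k₄ = 2πG` exactly is at most `K·2ⁿ·(n+1)`, with `K` INDEPENDENT of `P₀`, `G`
and `μ ∈ [μ₁, μ₂]` — the `γ^{-h}|h|` factor of BGM's isotropic four-sector lemma (the tree's `stub_fourSectorCount` is the case
`P₀` = a shell momentum in a fixed sector). The case `c = 0` of `offsetSectorCount_slack`. -/
theorem offsetSectorCount :
    ∀ μ₁ μ₂ : ℝ, -4 < μ₁ → μ₁ ≤ μ₂ → μ₂ < 0 → ∃ K : ℝ, 0 < K ∧ ∀ μ ∈ Set.Icc μ₁ μ₂, ∀ (n : ℕ) (G : Fin 2 → ℤ) (P₀ : Fin 2 → ℝ),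
      (((Finset.univ : Finset (Fin (sectorCount n) × Fin (sectorCount n) × Fin (sectorCount n))).filter (fun ω : Fin (sectorCount n) × Fin (sectorCount n) × Fin (sectorCount n) =>
        ∃ k : Fin 3 → Fin 2 → ℝ, (∀ j i, |k j i| < Real.pi) ∧ (∀ j, |sqDispersion (k j) - μ| ≤ sectorWidth n) ∧
          sectorIndex n (Complex.arg (⟨k 0 0, k 0 1⟩ : ℂ)) = (ω.1 : ℕ) ∧
          sectorIndex n (Complex.arg (⟨k 1 0, k 1 1⟩ : ℂ)) = (ω.2.1 : ℕ) ∧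
          sectorIndex n (Complex.arg (⟨k 2 0, k 2 1⟩ : ℂ)) = (ω.2.2 : ℕ) ∧
          (∀ i, P₀ i + ∑ j, k j i = 2 * Real.pi * (G i : ℝ)))).card : ℝ) ≤ K * 2 ^ n * ((n : ℝ) + 1) := by
  intro μ₁ μ₂ hμ₁ h12 hμ₂
  obtain ⟨K, hK, h⟩ := offsetSectorCount_slack μ₁ μ₂ 0 hμ₁ h12 hμ₂ le_rfl
  refine ⟨K, hK, fun μ hμ n G P₀ => le_trans ?_ (h μ hμ n G P₀)⟩
  exact_mod_cast Finset.card_le_card (Finset.monotone_filter_right _ fun ω _ hω => by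
    obtain ⟨k, hk, hsh, h0, h1, h2, hsum⟩ := hω
    exact ⟨k, hk, hsh, h0, h1, h2, fun i => by rw [hsum i, sub_self, abs_zero, zero_mul]⟩)

end Summit.HubbardSuperconductivity.HubbardSuperconductivity.Theorems

end
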